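import Summits.KontsevichZagierPeriods.KontsevichZagierPeriods.Theorems.UnfoldedStokesStokesGenerationStubIntervalTransport
import Summits.KontsevichZagierPeriods.KontsevichZagierPeriods.Theorems.UnfoldedStokesStokesGenerationStubEllipticTranslationDeriv
import Literature.NumberTheory.Transcendental.SemialgebraicLineDeriv
import Mathlib.Analysis.SpecialFunctions.Sqrt
import Mathlib.Analysis.Calculus.MeanValue

/-!
# `StokesGeneration` (stmt-KontsevichZagierPeriods-3586) — line `fibrewise_stokes`, stub `stub_ellipticTranslationRelator`

Registered rung stub E2 (rung 17, the genus-one entry point; wave 2, lead c6) of the line `fibrewise_stokes`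
of the crux `StokesGeneration` (route UnfoldedStokes): **the elliptic translation relator is fibrewise-Stokes
decomposable.** On the Weierstrass cubic `E : y² = f(x) = x³ + a₂x² + a₄x + a₆` with real algebraic
coefficients, fix an algebraic point `Q = (x₀, y₀) ∈ E` and an arc `x ∈ [α, β]` (algebraic ends, `f > 0`
there, `x₀ ∉ [α, β]`) of the branch `y = ε√f` (`ε = ±1`). Translation by `Q` sends `(x, y(x))` to
`(X₃(x), Y₃(x))` (chord slope `λ = (y − y₀)/(x − x₀)`, `X₃ = λ² − a₂ − x − x₀`, `Y₃ = −(y + λ(X₃ − x))`),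
and if `Y₃·y > 0` on the arc (the translate stays on the same branch, no `2`-torsion crossing) the
cube-normalised difference `∫_α^β dx/y − ∫_{X₃ α}^{X₃ β} dx/y`, i.e. the integrand
`s ↦ (β − α)/y(α + (β − α)s) − (X₃β − X₃α)/y(X₃α + (X₃β − X₃α)s)` on `[0,1]`, is fibrewise-Stokes
decomposable (`FibStokesDecomposable 1`, `Theorems/UnfoldedStokesDefs.lean`).

Proof. This is Kontsevich–Zagier's rule (2) between the two intervals `[α, β]` and `[X₃ α, X₃ β]`
(`stub_intervalTransport`) for the change of variables `φ = X₃` with `φ′ = Y₃/y` (translation invariance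
of `dx/y`, `stub_ellipticTranslationDeriv`) and `k₁ = k₂ = 1/y`. The image point lies on `E`:
`Y₃² = f(X₃)` (the chord through `(x, y)` and `Q` meets the cubic in a third point; an explicit polynomial
identity, `ellTransRel_chord_sq`), and `Y₃` has the sign `ε` of `y`, so `y(X₃ u) = ε|Y₃ u| = Y₃ u` and the
rule-(2) relation `1/y = (1/y ∘ X₃)·(Y₃/y)` holds. `X₃` is strictly increasing (`X₃′ = Y₃/y > 0`,
`strictMonoOn_of_deriv_pos`), hence maps `(α, β)` into `(X₃ α, X₃ β)`, and `f > 0` on `[X₃ α, X₃ β]`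
(every point there is some `X₃ u`, `intermediate_value_Icc`, and `f(X₃ u) = (Y₃ u)² > 0`). The data
`1/y`, `(1/y)′ = −y′/y²` (`y′ = εf′/(2√f)`), `X₃`, `Y₃/y` are `ℚ`-semialgebraic (polynomials with algebraic
coefficients, `√`, quotients: Bochnak–Coste–Roy Prop. 2.2.6) and continuous on the closed intervals.

References: J. H. Silverman, *The Arithmetic of Elliptic Curves* (2nd ed., 2009), III.2.3 (group law) and
III.5.1 (invariant differential); M. Kontsevich, D. Zagier, *Periods* (2001), §1.2 rule (2); J. Bochnak,
M. Coste, M.-F. Roy, *Real Algebraic Geometry* (1998), §2.1 and Prop. 2.2.6.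
-/

noncomputable section

-- `Summit.KontsevichZagierPeriods.KontsevichZagierPeriods.…` is the tree's mandated layout (single-conjunct summit).
set_option linter.dupNamespace false

namespace Summit.KontsevichZagierPeriods.KontsevichZagierPeriods.Cruxes.StokesGeneration.FibrewiseStokes

open MeasureTheory Set
open Literature.NumberTheory.Transcendental
open Literature.NumberTheory.Transcendental.KZ
open Literature.ModelTheory.ExponentialFields (IsSemialgebraic)

/-- **The chord meets the cubic in a third point.** If `(x, Y)` and `(x₀, y₀)` (`x ≠ x₀`) lie on
`y² = x³ + a₂x² + a₄x + a₆` and `L` is the slope of the chord, then the point with abscissa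
`X₃ = L² − a₂ − x − x₀` and ordinate `−(Y + L(X₃ − x))` lies on the cubic. Explicit polynomial identity:
`f(X₃) − (Y + L(X₃ − x))² = (X₃ − x)·B` with `(x − x₀)·B = (f x − Y²) + (y₀² − f x₀) = 0`.
[cite: SilvermanAEC2009, III.2.3] -/
private theorem ellTransRel_chord_sq {a₂ a₄ a₆ x x₀ Y y₀ L : ℝ} (hD : x - x₀ ≠ 0)
    (hL : L * (x - x₀) = Y - y₀) (hP : Y ^ 2 = x ^ 3 + a₂ * x ^ 2 + a₄ * x + a₆)
    (hQ : y₀ ^ 2 = x₀ ^ 3 + a₂ * x₀ ^ 2 + a₄ * x₀ + a₆) :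
    (-(Y + L * (L ^ 2 - a₂ - x - x₀ - x))) ^ 2 =
      (L ^ 2 - a₂ - x - x₀) ^ 3 + a₂ * (L ^ 2 - a₂ - x - x₀) ^ 2 + a₄ * (L ^ 2 - a₂ - x - x₀) + a₆ := by
  have hB : (x - x₀) ^ 2 - (3 * x + a₂ - L ^ 2) * (x - x₀)
      + (3 * x ^ 2 + 2 * a₂ * x + a₄ - 2 * Y * L) = 0 := by
    have h : (x - x₀) * ((x - x₀) ^ 2 - (3 * x + a₂ - L ^ 2) * (x - x₀)
        + (3 * x ^ 2 + 2 * a₂ * x + a₄ - 2 * Y * L)) = 0 := by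
      linear_combination (L * (x - x₀) - Y - y₀) * hL - hP + hQ
    exact (mul_eq_zero.1 h).resolve_left hD
  linear_combination (-(L ^ 2 - a₂ - x - x₀ - x)) * hB + hP

/-- The closed slab `{z ∈ ℝ¹ | a ≤ z 0 ≤ b}` with real algebraic ends is `ℚ`-semialgebraic.
[cite: BochnakCosteRoy1998, §2.1] -/
private theorem ellTransRel_isSemialgebraic_slab {a b : ℝ} (ha : IsAlgebraic ℚ a)
    (hb : IsAlgebraic ℚ b) : IsSemialgebraic ℚ {z : Fin 1 → ℝ | z 0 ∈ Set.Icc a b} := by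
  have h : {z : Fin 1 → ℝ | z 0 ∈ Set.Icc a b} =
      {z : Fin 1 → ℝ | z 0 < a}ᶜ ∩ {z : Fin 1 → ℝ | b < z 0}ᶜ := by
    ext z
    simp [not_lt]
  rw [h]
  exact (isSemialgebraic_setOf_apply_lt_const ha 0).compl.inter
    (isSemialgebraic_setOf_const_lt_apply hb 0).compl

/-- **Registered stub `stub_ellipticTranslationRelator` (rung 17, E2): the elliptic translation relator is
fibrewise-Stokes decomposable.** On `E : y² = x³ + a₂x² + a₄x + a₆` (real algebraic data), for the branch
`y = ε√f` over `[α, β]` (`f > 0` there), an algebraic point `(x₀, y₀) ∈ E` with `x₀ ∉ [α, β]`, and the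
translate `(X₃, Y₃) = (x, y(x)) ⊕ (x₀, y₀)` staying on the same branch (`Y₃·y > 0`), the normalised
integrand of `∫_α^β dx/y − ∫_{X₃ α}^{X₃ β} dx/y` is `FibStokesDecomposable 1`: rule (2) between two intervals
(`stub_intervalTransport`) along `φ = X₃`, `φ′ = Y₃/y` (`stub_ellipticTranslationDeriv`), `k₁ = k₂ = 1/y`.
[cite: KontsevichZagier2001, §1.2 rule (2)] -/
theorem stub_ellipticTranslationRelator (a₂ a₄ a₆ x₀ y₀ α β ε : ℝ)
    (ha₂ : IsAlgebraic ℚ a₂) (ha₄ : IsAlgebraic ℚ a₄) (ha₆ : IsAlgebraic ℚ a₆)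
    (hx₀ : IsAlgebraic ℚ x₀) (hy₀ : IsAlgebraic ℚ y₀) (hα : IsAlgebraic ℚ α) (hβ : IsAlgebraic ℚ β)
    (hαβ : α < β) (hε : ε = 1 ∨ ε = -1)
    (hQ : y₀ ^ 2 = x₀ ^ 3 + a₂ * x₀ ^ 2 + a₄ * x₀ + a₆) (hx₀I : x₀ < α ∨ β < x₀)
    (hf : ∀ u ∈ Set.Icc α β, 0 < u ^ 3 + a₂ * u ^ 2 + a₄ * u + a₆)
    (y lam X₃ Y₃ : ℝ → ℝ)
    (hy : y = fun u => ε * Real.sqrt (u ^ 3 + a₂ * u ^ 2 + a₄ * u + a₆))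
    (hlam : lam = fun u => (y u - y₀) / (u - x₀))
    (hX₃ : X₃ = fun u => lam u ^ 2 - a₂ - u - x₀)
    (hY₃ : Y₃ = fun u => -(y u + lam u * (X₃ u - u)))
    (hside : ∀ u ∈ Set.Icc α β, 0 < Y₃ u * y u) :
    FibStokesDecomposable 1 (fun s => (β - α) / y (α + (β - α) * s 0) -
      (X₃ β - X₃ α) / y (X₃ α + (X₃ β - X₃ α) * s 0)) := by
  -- the cubic `f` and its derivative `f'`
  obtain ⟨f, hfdef⟩ : ∃ f : ℝ → ℝ, f = fun u => u ^ 3 + a₂ * u ^ 2 + a₄ * u + a₆ := ⟨_, rfl⟩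
  obtain ⟨f', hf'def⟩ : ∃ f' : ℝ → ℝ, f' = fun u => 3 * u ^ 2 + 2 * a₂ * u + a₄ := ⟨_, rfl⟩
  have hfu : ∀ u, f u = u ^ 3 + a₂ * u ^ 2 + a₄ * u + a₆ := fun u => by rw [hfdef]
  have hf0 : ∀ u ∈ Icc α β, 0 < f u := fun u hu => by rw [hfu]; exact hf u hu
  have hyu : ∀ u, y u = ε * √(f u) := fun u => by rw [hy, hfu]
  have hlamu : ∀ u, lam u = (y u - y₀) / (u - x₀) := fun u => by rw [hlam]
  have hX₃u : ∀ u, X₃ u = lam u ^ 2 - a₂ - u - x₀ := fun u => by rw [hX₃]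
  have hY₃u : ∀ u, Y₃ u = -(y u + lam u * (X₃ u - u)) := fun u => by rw [hY₃]
  -- `ε = ±1`
  have hεalg : IsAlgebraic ℚ ε := by
    rcases hε with h | h <;> rw [h]
    · exact isAlgebraic_one
    · exact isAlgebraic_one.neg
  have hε2 : ε ^ 2 = 1 := by rcases hε with h | h <;> rw [h] <;> norm_num
  have hεne : ε ≠ 0 := by rcases hε with h | h <;> rw [h] <;> norm_num
  -- `x₀ ∉ [α, β]`
  have hux₀ : ∀ u ∈ Icc α β, u - x₀ ≠ 0 := by
    intro u hu h
    have hux : u = x₀ := sub_eq_zero.1 h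
    rcases hx₀I with h0 | h0
    · exact absurd hu.1 (not_le.2 (hux ▸ h0))
    · exact absurd hu.2 (not_le.2 (hux ▸ h0))
  -- the branch `y = ε √f`: squares, nonvanishing, continuity, derivative
  have hysq : ∀ u, 0 ≤ f u → y u ^ 2 = f u := fun u h0 => by
    rw [hyu, mul_pow, hε2, one_mul, Real.sq_sqrt h0]
  have hyne : ∀ u, 0 < f u → y u ≠ 0 := fun u h0 => by
    rw [hyu]
    exact mul_ne_zero hεne (Real.sqrt_pos.2 h0).ne'
  have hfc : Continuous f := by rw [hfdef]; fun_prop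
  have hf'c : Continuous f' := by rw [hf'def]; fun_prop
  have hyf : y = fun u => ε * √(f u) := funext hyu
  have hyc : Continuous y := by rw [hyf]; exact continuous_const.mul hfc.sqrt
  have hfd : ∀ x, HasDerivAt f (f' x) x := by
    intro x
    have hx' : f' x = 3 * x ^ 2 + 2 * a₂ * x + a₄ := by rw [hf'def]
    rw [hx', hfdef]
    refine (((((hasDerivAt_id' x).fun_pow 3).fun_add
      (((hasDerivAt_id' x).fun_pow 2).const_mul a₂)).fun_add
      ((hasDerivAt_id' x).const_mul a₄)).add_const a₆).congr_deriv ?_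
    norm_num
    ring
  have hyd : ∀ x, 0 < f x → HasDerivAt y (ε * (f' x / (2 * √(f x)))) x := by
    intro x h0
    rw [hyf]
    exact ((hfd x).sqrt h0.ne').const_mul ε
  have hopen : IsOpen {v : ℝ | 0 < f v} := isOpen_lt continuous_const hfc
  -- continuity of `λ`, `X₃`, `Y₃` on `[α, β]`
  have hlamc : ContinuousOn lam (Icc α β) := by
    rw [hlam]
    exact (hyc.continuousOn.sub continuousOn_const).div
      (continuousOn_id.sub continuousOn_const) hux₀
  have hX₃c : ContinuousOn X₃ (Icc α β) := by
    rw [hX₃]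
    exact (((hlamc.pow 2).sub continuousOn_const).sub continuousOn_id).sub continuousOn_const
  have hY₃c : ContinuousOn Y₃ (Icc α β) := by
    rw [hY₃]
    exact (hyc.continuousOn.add (hlamc.mul (hX₃c.sub continuousOn_id))).neg
  have hφ'c : ContinuousOn (fun u => Y₃ u / y u) (Icc α β) :=
    hY₃c.div hyc.continuousOn fun u hu => hyne u (hf0 u hu)
  -- the translate lies on the curve: `Y₃² = f(X₃)` on `[α, β]`
  have hchord : ∀ u ∈ Icc α β, Y₃ u ^ 2 = f (X₃ u) := by
    intro u hu
    have hL : lam u * (u - x₀) = y u - y₀ := by rw [hlamu, div_mul_cancel₀ _ (hux₀ u hu)]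
    have hP : y u ^ 2 = u ^ 3 + a₂ * u ^ 2 + a₄ * u + a₆ := by rw [hysq u (hf0 u hu).le, hfu]
    have h := ellTransRel_chord_sq (hux₀ u hu) hL hP hQ
    rw [hY₃u, hX₃u, hfu]
    exact h
  have hY₃ne : ∀ u ∈ Icc α β, Y₃ u ≠ 0 := fun u hu => left_ne_zero_of_mul (hside u hu).ne'
  -- `Y₃` has the sign `ε` of `y`, so `y (X₃ u) = ε |Y₃ u| = Y₃ u`
  have hyX₃ : ∀ u ∈ Icc α β, y (X₃ u) = Y₃ u := by
    intro u hu
    have hsgn : 0 < Y₃ u * ε := by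
      have h := hside u hu
      rw [hyu u, ← mul_assoc] at h
      exact pos_of_mul_pos_left h (Real.sqrt_nonneg _)
    rw [hyu, ← hchord u hu, Real.sqrt_sq_eq_abs]
    rcases hε with h1 | h1
    · rw [h1, mul_one] at hsgn
      rw [h1, one_mul, abs_of_pos hsgn]
    · rw [h1, mul_neg_one] at hsgn
      rw [h1, neg_one_mul, abs_of_neg (neg_pos.1 hsgn), neg_neg]
  -- translation invariance of `dx/y`: `X₃′ = Y₃/y` inside the arc
  have hX₃d : ∀ u ∈ Ioo α β, HasDerivAt X₃ (Y₃ u / y u) u := by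
    intro u hu
    have hu' : u ∈ Icc α β := Ioo_subset_Icc_self hu
    have h0 : 0 < f u := hf0 u hu'
    have hP : ∀ᶠ v in nhds u, y v ^ 2 = v ^ 3 + a₂ * v ^ 2 + a₄ * v + a₆ := by
      filter_upwards [hopen.mem_nhds h0] with v hv
      have hv' : 0 < f v := hv
      rw [hysq v hv'.le, hfu]
    have h := stub_ellipticTranslationDeriv a₂ a₄ a₆ x₀ y₀ y (ε * (f' u / (2 * √(f u)))) u
      (sub_ne_zero.1 (hux₀ u hu')) hQ hP (hyd u h0) (hyne u h0)
    rw [hY₃, hX₃, hlam]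
    exact h
  -- `X₃` is strictly increasing on `[α, β]`
  have hmono : StrictMonoOn X₃ (Icc α β) := by
    refine strictMonoOn_of_deriv_pos (convex_Icc α β) hX₃c fun u hu => ?_
    rw [interior_Icc] at hu
    rw [(hX₃d u hu).deriv]
    exact div_pos_iff.2 (mul_pos_iff.1 (hside u (Ioo_subset_Icc_self hu)))
  have hγδ : X₃ α < X₃ β := hmono (left_mem_Icc.2 hαβ.le) (right_mem_Icc.2 hαβ.le) hαβ
  have hφI : ∀ u ∈ Ioo α β, X₃ u ∈ Ioo (X₃ α) (X₃ β) := fun u hu =>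
    ⟨hmono (left_mem_Icc.2 hαβ.le) (Ioo_subset_Icc_self hu) hu.1,
      hmono (Ioo_subset_Icc_self hu) (right_mem_Icc.2 hαβ.le) hu.2⟩
  -- `f > 0` on the image interval `[X₃ α, X₃ β] = X₃ '' [α, β]`
  have hf0' : ∀ v ∈ Icc (X₃ α) (X₃ β), 0 < f v := by
    intro v hv
    obtain ⟨u, hu, huv⟩ := intermediate_value_Icc hαβ.le hX₃c hv
    rw [← huv, ← hchord u hu]
    exact sq_pos_of_ne_zero (hY₃ne u hu)
  -- algebraicity of the new endpoints `X₃ α`, `X₃ β`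
  have hX₃alg : ∀ u ∈ Icc α β, IsAlgebraic ℚ u → IsAlgebraic ℚ (X₃ u) := by
    intro u hu hualg
    have hfalg : IsAlgebraic ℚ (f u) := by
      rw [hfu]
      exact (((hualg.pow 3).add (ha₂.mul (hualg.pow 2))).add (ha₄.mul hualg)).add ha₆
    have hsqrt : IsAlgebraic ℚ (√(f u)) :=
      IsAlgebraic.of_pow two_pos (by rw [Real.sq_sqrt (hf0 u hu).le]; exact hfalg)
    have hyalg : IsAlgebraic ℚ (y u) := by rw [hyu]; exact hεalg.mul hsqrt
    have hlamalg : IsAlgebraic ℚ (lam u) := by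
      rw [hlamu, div_eq_mul_inv]
      exact (hyalg.sub hy₀).mul (hualg.sub hx₀).inv
    rw [hX₃u]
    exact (((hlamalg.pow 2).sub ha₂).sub hualg).sub hx₀
  have hγalg : IsAlgebraic ℚ (X₃ α) := hX₃alg α (left_mem_Icc.2 hαβ.le) hα
  have hδalg : IsAlgebraic ℚ (X₃ β) := hX₃alg β (right_mem_Icc.2 hαβ.le) hβ
  -- `ℚ`-semialgebraicity of the data on the two closed slabs
  have hS₁ : IsSemialgebraic ℚ {z : Fin 1 → ℝ | z 0 ∈ Set.Icc α β} :=
    ellTransRel_isSemialgebraic_slab hα hβ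
  have hS₂ : IsSemialgebraic ℚ {z : Fin 1 → ℝ | z 0 ∈ Set.Icc (X₃ α) (X₃ β)} :=
    ellTransRel_isSemialgebraic_slab hγalg hδalg
  have sf : ∀ {S : Set (Fin 1 → ℝ)}, IsSemialgebraic ℚ S →
      IsSemialgebraicFunOn ℚ S (fun z => f (z 0)) := by
    intro S hS
    exact (((((isSemialgebraicFunOn_apply hS 0).fun_pow 3).fun_add
      ((isSemialgebraicFunOn_const_of_isAlgebraic hS ha₂).fun_mul
        ((isSemialgebraicFunOn_apply hS 0).fun_pow 2))).fun_add
      ((isSemialgebraicFunOn_const_of_isAlgebraic hS ha₄).fun_mul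
        (isSemialgebraicFunOn_apply hS 0))).fun_add
      (isSemialgebraicFunOn_const_of_isAlgebraic hS ha₆)).congr fun z _ => (hfu (z 0)).symm
  have sf' : ∀ {S : Set (Fin 1 → ℝ)}, IsSemialgebraic ℚ S →
      IsSemialgebraicFunOn ℚ S (fun z => f' (z 0)) := by
    intro S hS
    refine ((((isSemialgebraicFunOn_const_ofNat hS 3).fun_mul
      ((isSemialgebraicFunOn_apply hS 0).fun_pow 2)).fun_add
      (((isSemialgebraicFunOn_const_ofNat hS 2).fun_mul
        (isSemialgebraicFunOn_const_of_isAlgebraic hS ha₂)).fun_mul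
        (isSemialgebraicFunOn_apply hS 0))).fun_add
      (isSemialgebraicFunOn_const_of_isAlgebraic hS ha₄)).congr fun z _ => ?_
    simp only [hf'def]
  have sy : ∀ {S : Set (Fin 1 → ℝ)}, IsSemialgebraic ℚ S →
      IsSemialgebraicFunOn ℚ S (fun z => y (z 0)) := by
    intro S hS
    exact ((isSemialgebraicFunOn_const_of_isAlgebraic hS hεalg).fun_mul (sf hS).fun_sqrt).congr
      fun z _ => (hyu (z 0)).symm
  have slam : IsSemialgebraicFunOn ℚ {z : Fin 1 → ℝ | z 0 ∈ Set.Icc α β} (fun z => lam (z 0)) :=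
    (((sy hS₁).fun_sub (isSemialgebraicFunOn_const_of_isAlgebraic hS₁ hy₀)).div
      ((isSemialgebraicFunOn_apply hS₁ 0).fun_sub (isSemialgebraicFunOn_const_of_isAlgebraic hS₁ hx₀))
      (fun z hz => hux₀ (z 0) hz)).congr fun z _ => (hlamu (z 0)).symm
  have sX₃ : IsSemialgebraicFunOn ℚ {z : Fin 1 → ℝ | z 0 ∈ Set.Icc α β} (fun z => X₃ (z 0)) :=
    ((((slam.fun_pow 2).fun_sub (isSemialgebraicFunOn_const_of_isAlgebraic hS₁ ha₂)).fun_sub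
      (isSemialgebraicFunOn_apply hS₁ 0)).fun_sub
      (isSemialgebraicFunOn_const_of_isAlgebraic hS₁ hx₀)).congr fun z _ => (hX₃u (z 0)).symm
  have sY₃ : IsSemialgebraicFunOn ℚ {z : Fin 1 → ℝ | z 0 ∈ Set.Icc α β} (fun z => Y₃ (z 0)) :=
    ((sy hS₁).fun_add (slam.fun_mul (sX₃.fun_sub (isSemialgebraicFunOn_apply hS₁ 0)))).fun_neg.congr
      fun z _ => (hY₃u (z 0)).symm
  have sφ' : IsSemialgebraicFunOn ℚ {z : Fin 1 → ℝ | z 0 ∈ Set.Icc α β}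
      (fun z => Y₃ (z 0) / y (z 0)) :=
    sY₃.div (sy hS₁) fun z hz => hyne _ (hf0 _ hz)
  have sk₁ : IsSemialgebraicFunOn ℚ {z : Fin 1 → ℝ | z 0 ∈ Set.Icc α β} (fun z => (y (z 0))⁻¹) :=
    (sy hS₁).fun_inv
  have sk₂ : IsSemialgebraicFunOn ℚ {z : Fin 1 → ℝ | z 0 ∈ Set.Icc (X₃ α) (X₃ β)}
      (fun z => (y (z 0))⁻¹) :=
    (sy hS₂).fun_inv
  have sk₂' : IsSemialgebraicFunOn ℚ {z : Fin 1 → ℝ | z 0 ∈ Set.Icc (X₃ α) (X₃ β)}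
      (fun z => -(ε * (f' (z 0) / (2 * √(f (z 0))))) / y (z 0) ^ 2) :=
    ((isSemialgebraicFunOn_const_of_isAlgebraic hS₂ hεalg).fun_mul ((sf' hS₂).div
      ((isSemialgebraicFunOn_const_ofNat hS₂ 2).fun_mul (sf hS₂).fun_sqrt)
      fun z hz => mul_ne_zero two_ne_zero (Real.sqrt_pos.2 (hf0' _ hz)).ne')).fun_neg.div
      ((sy hS₂).fun_pow 2) fun z hz => pow_ne_zero 2 (hyne _ (hf0' _ hz))
  -- continuity of the data on the closed intervals
  have hk₁c : ContinuousOn (fun v => (y v)⁻¹) (Icc α β) :=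
    hyc.continuousOn.inv₀ fun v hv => hyne v (hf0 v hv)
  have hk₂c : ContinuousOn (fun v => (y v)⁻¹) (Icc (X₃ α) (X₃ β)) :=
    hyc.continuousOn.inv₀ fun v hv => hyne v (hf0' v hv)
  have hk₂'c : ContinuousOn (fun v => -(ε * (f' v / (2 * √(f v)))) / y v ^ 2) (Icc (X₃ α) (X₃ β)) := by
    refine ((continuousOn_const.mul (hf'c.continuousOn.div
      (continuousOn_const.mul hfc.continuousOn.sqrt) ?_)).neg).div (hyc.continuousOn.pow 2) ?_
    · exact fun v hv => mul_ne_zero two_ne_zero (Real.sqrt_pos.2 (hf0' v hv)).ne'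
    · exact fun v hv => pow_ne_zero 2 (hyne v (hf0' v hv))
  -- the derivative of `k₂ = 1/y` inside the image interval
  have hk₂d : ∀ v ∈ Ioo (X₃ α) (X₃ β),
      HasDerivAt (fun v => (y v)⁻¹) (-(ε * (f' v / (2 * √(f v)))) / y v ^ 2) v := fun v hv => by
    have h0 : 0 < f v := hf0' v (Ioo_subset_Icc_self hv)
    exact (hyd v h0).fun_inv (hyne v h0)
  -- the rule-(2) relation `1/y = (1/y ∘ X₃)·(Y₃/y)` inside the arc
  have hrel : ∀ u ∈ Ioo α β, (y u)⁻¹ = (y (X₃ u))⁻¹ * (Y₃ u / y u) := by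
    intro u hu
    have hu' : u ∈ Icc α β := Ioo_subset_Icc_self hu
    rw [hyX₃ u hu', inv_mul_eq_div, div_div_cancel_left' (hY₃ne u hu')]
  -- rule (2) between the two intervals
  have hT := stub_intervalTransport α β (X₃ α) (X₃ β) hαβ hγδ hα hβ hγalg hδalg
    (fun v => (y v)⁻¹) (fun v => (y v)⁻¹) (fun v => -(ε * (f' v / (2 * √(f v)))) / y v ^ 2)
    X₃ (fun u => Y₃ u / y u) sk₁ sk₂ sk₂' sX₃ sφ' hk₁c hk₂c hk₂'c hX₃c hφ'c hk₂d hX₃d rfl rfl hφI hrel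
  refine fibStokesDecomposable_congr_off_null 1 _ _ ∅
    Literature.ModelTheory.ExponentialFields.isSemialgebraic_empty measure_empty ?_ hT
  intro x _ _
  rw [div_eq_mul_inv, div_eq_mul_inv]

end Summit.KontsevichZagierPeriods.KontsevichZagierPeriods.Cruxes.StokesGeneration.FibrewiseStokes

end
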